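import Summits.NavierStokesRegularity.NavierStokesRegularity.Theorems.SoloRefuteAlneel2026Thm21Fields
import HarnessLib
/-!
# C156 `Alneel2026` — SECOND refuter's centre-free kernel witness against Theorem 2.1 itself

`Literature.Claims.NS.Alneel2026.Thm21 C` (Theorem 2.1 p. 2 l. 2–6, the «Universal Scale Law»
`R(t)² X(t) ≤ 16 C E₀` with the charitable half-energy radius `R_inf` of Def 1.2) is false for EVERY real `C`,
already on the initial slice (`Thm21_field C`, p. 2 display (5)/(8) read on data via the skeleton's own bridge
`thm21_field_of_thm21` = the tree's local existence): the single-scale, divergence-free, compactly supported data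
`w_N = curl(φ · N⁻¹(cos N x₂, sin N x₂, 0))` (`φ` a fixed bump, `= 1` on `B₁`, supported in `B₂`) satisfy, uniformly
in `N ≥ 1`, `‖w_N‖_∞ ≤ M := 1 + ‖curl‖·sup‖∇φ‖`, hence `E₀(w_N) ≤ M²|B̄₂|/2` and — since a ball of radius
`r < r₀ := 1/(2(M²+1))` carries energy `≤ M² r³ |B₁| < |B₁|/4 ≤ E₀/2` — `R_inf(w_N) ≥ r₀`; while on `B₁`,
`w_N = −(cos N x₂, sin N x₂, 0)` so `X(w_N) ≥ N²|B₁|`. The scale law then reads `r₀² N² |B₁| ≤ 16|C|·M²|B̄₂|/2`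
for every `N` — absurd. No centre (`IsCentre`) has to be exhibited: `R_inf` is bounded below directly.
Consequences: `¬ Thm21 C` (along solutions), `¬ Thm21_ex`, and `¬ (Step2_localisation ∧ Step6_display C ∧ Step5_L21)`
through the printed derivation `thm21_of_steps`. Scratch of ns-claims-refuter-2 g7 (second refuter; records-grade
ADDENDUM material for the filer under conv. (b)); it does not move the keyed token `Step6_display` (VERDICT
refuter-8 g4 12:35:26Z, CONCUR 12:37:37Z).

WHAT THIS IS NOT: not a claim about NS regularity or blow-up; not a claim about any author beyond the
typed locator.
-/


set_option linter.dupNamespace false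

noncomputable section

open Real Set Function MeasureTheory Metric
open scoped ENNReal NNReal ContDiff Topology

namespace Summit.NavierStokesRegularity.NavierStokesRegularity.Theorems.Alneel2026Second

open Literature.Analysis Literature.Analysis.FluidPDE
open Literature.Claims.NS.Alneel2026
open Literature.Claims.NS.Chae2007 (IsDatum)

/-! ### Energy, enstrophy and the cap radius of `w_N` -/

/-- `v₁ = |B₁(0)|`. [folklore] -/
def v1 : ℝ≥0∞ := volume (ball (0 : E3) 1)

/-- kit lemma (plumbing). [folklore] -/
theorem v1_ne_zero : v1 ≠ 0 := (measure_ball_pos volume (0 : E3) one_pos).ne'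
/-- kit lemma (plumbing). [folklore] -/
theorem v1_ne_top : v1 ≠ ⊤ := measure_ball_lt_top.ne

/-- `|B₁| ≤ ∫ |w_N|²`. [folklore] -/
theorem v1_le_mass {N : ℝ} (hN : N ≠ 0) : v1 ≤ ∫⁻ x, ‖w N x‖ₑ ^ 2 := by
  have h1 : ∫⁻ x in ball (0 : E3) 1, ‖w N x‖ₑ ^ 2 = ∫⁻ _ in ball (0 : E3) 1, (1 : ℝ≥0∞) := by
    refine setLIntegral_congr_fun measurableSet_ball (fun x hx => ?_)
    rw [w_eq_Ws hN hx, ← ofReal_norm, norm_Ws, ENNReal.ofReal_one, one_pow]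
  calc v1 = ∫⁻ _ in ball (0 : E3) 1, (1 : ℝ≥0∞) := by rw [setLIntegral_one]; rfl
    _ = ∫⁻ x in ball (0 : E3) 1, ‖w N x‖ₑ ^ 2 := h1.symm
    _ ≤ ∫⁻ x, ‖w N x‖ₑ ^ 2 := setLIntegral_le_lintegral _ _

/-- pointwise square bound in `ℝ≥0∞`. [folklore] -/
theorem enorm_sq_w_le {K : ℝ} (hK : ∀ x, ‖fderiv ℝ φ x‖ ≤ K) {N : ℝ} (hN : 1 ≤ N) (x : E3) :
    ‖w N x‖ₑ ^ 2 ≤ ENNReal.ofReal ((1 + ‖curlCLM‖ * K) ^ 2) := by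
  rw [← ofReal_norm, ← ENNReal.ofReal_pow (norm_nonneg _)]
  exact ENNReal.ofReal_le_ofReal (pow_le_pow_left₀ (norm_nonneg _) (norm_w_le hK hN x) 2)

/-- `∫ |w_N|² ≤ M² |B̄₂|`. [folklore] -/
theorem mass_le {K : ℝ} (hK : ∀ x, ‖fderiv ℝ φ x‖ ≤ K) {N : ℝ} (hN : 1 ≤ N) :
    ∫⁻ x, ‖w N x‖ₑ ^ 2 ≤ ENNReal.ofReal ((1 + ‖curlCLM‖ * K) ^ 2) * volume (closedBall (0 : E3) 2) := by
  calc ∫⁻ x, ‖w N x‖ₑ ^ 2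
        ≤ ∫⁻ x, (closedBall (0 : E3) 2).indicator (fun _ => ENNReal.ofReal ((1 + ‖curlCLM‖ * K) ^ 2)) x := by
        refine lintegral_mono fun x => ?_
        by_cases hx : x ∈ closedBall (0 : E3) 2
        · rw [indicator_of_mem hx]; exact enorm_sq_w_le hK hN x
        · have : w N x = 0 := image_eq_zero_of_notMem_tsupport fun h => hx (tsupport_w_subset N h)
          simp [this]
    _ = ENNReal.ofReal ((1 + ‖curlCLM‖ * K) ^ 2) * volume (closedBall (0 : E3) 2) :=
        lintegral_indicator_const measurableSet_closedBall _

/-- `∫_{B(x₀,r)} |w_N|² ≤ M² r³ |B₁|`. [folklore] -/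
theorem locEnergy_le {K : ℝ} (hK : ∀ x, ‖fderiv ℝ φ x‖ ≤ K) {N : ℝ} (hN : 1 ≤ N) (x₀ : E3) {r : ℝ}
    (hr : 0 < r) :
    locEnergy (w N) x₀ r ≤ ENNReal.ofReal ((1 + ‖curlCLM‖ * K) ^ 2) * (ENNReal.ofReal (r ^ 3) * v1) := by
  unfold locEnergy
  calc ∫⁻ y in ball x₀ r, ‖w N y‖ₑ ^ 2 ≤ ∫⁻ _ in ball x₀ r, ENNReal.ofReal ((1 + ‖curlCLM‖ * K) ^ 2) :=
        lintegral_mono fun y => enorm_sq_w_le hK hN y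
    _ = ENNReal.ofReal ((1 + ‖curlCLM‖ * K) ^ 2) * (ENNReal.ofReal (r ^ 3) * v1) := by
        rw [setLIntegral_const, Measure.addHaar_ball volume x₀ hr.le, finrank_euclideanSpace_fin]; rfl

/-- kit lemma (plumbing). [folklore] -/
theorem ofReal_quarter_mul (a : ℝ≥0∞) (ha : a ≠ ⊤) :
    ENNReal.ofReal (1 / 4) * a = ENNReal.ofReal (1 / 4 * a.toReal) := by
  rw [ENNReal.ofReal_mul (by norm_num), ENNReal.ofReal_toReal ha]

/-- **Uniform cap-radius bound**: `R_inf(w_N) ≥ r₀ = 1/(2(M²+1))` whenever the threshold `E₀/2` is at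
least `|B₁|/4` (true for `E₀ = E(w_N)`). [folklore] -/
theorem rinf_ge {K : ℝ} (hK : ∀ x, ‖fderiv ℝ φ x‖ ≤ K) {N : ℝ} (hN : 1 ≤ N) {E₀ : ℝ}
    (hE : v1.toReal / 4 ≤ E₀ / 2) :
    ENNReal.ofReal (1 / (2 * ((1 + ‖curlCLM‖ * K) ^ 2 + 1))) ≤ Rinf E₀ (w N) := by
  set M : ℝ := 1 + ‖curlCLM‖ * K with hM
  set r0 : ℝ := 1 / (2 * (M ^ 2 + 1)) with hr0
  have hr0pos : 0 < r0 := by positivity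
  have hkey : M ^ 2 * r0 ^ 3 < 1 / 4 := by
    have h1 : r0 ≤ 1 / 2 := by
      rw [hr0, div_le_div_iff₀ (by positivity) (by norm_num)]; nlinarith [sq_nonneg M]
    have h2 : M ^ 2 * r0 ≤ 1 / 2 := by
      rw [hr0, ← mul_div_assoc, mul_one, div_le_div_iff₀ (by positivity) (by norm_num)]
      nlinarith [sq_nonneg M]
    have h3 : r0 ^ 3 ≤ r0 * (1 / 4) := by nlinarith [sq_nonneg r0, hr0pos]
    nlinarith [sq_nonneg M, h2, h3, mul_nonneg (sq_nonneg M) hr0pos.le]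
  have hE' : v1 * ENNReal.ofReal (1 / 4) ≤ ENNReal.ofReal (E₀ / 2) := by
    rw [mul_comm, ofReal_quarter_mul v1 v1_ne_top]; exact ENNReal.ofReal_le_ofReal (by linarith)
  unfold Rinf
  refine le_sInf ?_
  rintro _ ⟨r, ⟨hr, x₀, hx₀⟩, rfl⟩
  refine ENNReal.ofReal_le_ofReal (not_lt.1 fun hlt => ?_)
  have hrr : r ^ 3 ≤ r0 ^ 3 := pow_le_pow_left₀ hr.le hlt.le 3
  have hchain : locEnergy (w N) x₀ r < ENNReal.ofReal (E₀ / 2) := by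
    calc locEnergy (w N) x₀ r ≤ ENNReal.ofReal (M ^ 2) * (ENNReal.ofReal (r ^ 3) * v1) := locEnergy_le hK hN x₀ hr
      _ ≤ ENNReal.ofReal (M ^ 2) * (ENNReal.ofReal (r0 ^ 3) * v1) := by gcongr
      _ = v1 * ENNReal.ofReal (M ^ 2 * r0 ^ 3) := by rw [ENNReal.ofReal_mul (sq_nonneg _)]; ring
      _ < v1 * ENNReal.ofReal (1 / 4) :=
          ENNReal.mul_lt_mul_right v1_ne_zero v1_ne_top ((ENNReal.ofReal_lt_ofReal_iff (by norm_num)).2 hkey)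
      _ ≤ ENNReal.ofReal (E₀ / 2) := hE'
  exact absurd hx₀ (not_le.2 hchain)

/-- `N² |B₁| ≤ X(w_N)` in `ℝ≥0∞`. [folklore] -/
theorem xeF_ge {N : ℝ} (hN : N ≠ 0) : ENNReal.ofReal (N ^ 2) * v1 ≤ XeF (w N) := by
  unfold XeF
  have hae : ∀ᵐ x ∂(volume.restrict (ball (0 : E3) 1)),
      ENNReal.ofReal (N ^ 2) ≤ ENNReal.ofReal (frobeniusNormSq (fderiv ℝ (w N) x)) :=
    (ae_restrict_iff' measurableSet_ball).2 (Filter.Eventually.of_forall fun x hx =>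
      ENNReal.ofReal_le_ofReal (frob_w_ge hN hx))
  calc ENNReal.ofReal (N ^ 2) * v1 = ∫⁻ _ in ball (0 : E3) 1, ENNReal.ofReal (N ^ 2) := by
        rw [setLIntegral_const]; rfl
    _ ≤ ∫⁻ x in ball (0 : E3) 1, ENNReal.ofReal (frobeniusNormSq (fderiv ℝ (w N) x)) := lintegral_mono_ae hae
    _ ≤ ∫⁻ x, ENNReal.ofReal (frobeniusNormSq (fderiv ℝ (w N) x)) := setLIntegral_le_lintegral _ _

/-- continuity of the Frobenius square (finite sum of squares of norms). [folklore] -/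
theorem continuous_frob : Continuous fun L : E3 →L[ℝ] E3 => frobeniusNormSq L := by
  unfold frobeniusNormSq
  refine continuous_finsetSum _ fun i _ => ?_
  exact ((ContinuousLinearMap.apply ℝ E3 (stdOrthonormalBasis ℝ E3 i)).continuous.norm).pow 2

/-- `X(w_N) < ∞` (continuous compactly supported integrand). [folklore] -/
theorem xeF_lt_top (N : ℝ) : XeF (w N) < ⊤ := by
  unfold XeF
  have hc : Continuous fun x => frobeniusNormSq (fderiv ℝ (w N) x) :=
    continuous_frob.comp ((contDiff_w N).continuous_fderiv (by simp))
  have hs : HasCompactSupport fun x => frobeniusNormSq (fderiv ℝ (w N) x) :=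
    ((hasCompactSupport_w N).fderiv (𝕜 := ℝ)).comp_left (g := fun L => frobeniusNormSq L)
      (by simp [frobeniusNormSq])
  have hi : Integrable (fun x => frobeniusNormSq (fderiv ℝ (w N) x)) volume :=
    hc.integrable_of_hasCompactSupport hs
  exact lt_of_le_of_lt (lintegral_mono fun x => Real.ofReal_le_enorm _) hi.2

/-- kit lemma (plumbing). [folklore] -/
theorem ofReal_XF (N : ℝ) : ENNReal.ofReal (XF (w N)) = XeF (w N) := by
  rw [XF, ENNReal.ofReal_toReal (xeF_lt_top N).ne]

/-- kit lemma (plumbing). [folklore] -/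
theorem energyF_nonneg (v : E3 → E3) : 0 ≤ energyF v := by
  unfold energyF; positivity

/-! ### The refutation of Theorem 2.1 (on data, hence along solutions) -/

/-- **Theorem 2.1's scale law fails on data, for every constant**: the family `w_N` has energy of order one,
cap radius `R_inf ≥ r₀ > 0` uniformly in `N`, and enstrophy `≥ N²|B₁|`.
[cite: Alneel2026, Theorem 2.1 p.2 l.2–6; Def 1.2 p.1 l.50–62] -/
theorem not_Thm21_field (C : ℝ) : ¬ Thm21_field C := by
  intro hT
  obtain ⟨K, hK0, hK⟩ := exists_bound_fderiv_φ
  set M : ℝ := 1 + ‖curlCLM‖ * K with hM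
  set r0 : ℝ := 1 / (2 * (M ^ 2 + 1)) with hr0
  have hr0pos : 0 < r0 := by positivity
  set mU : ℝ≥0∞ := ENNReal.ofReal (M ^ 2) * volume (closedBall (0 : E3) 2) with hmU_def
  have hmU : mU < ⊤ := ENNReal.mul_lt_top ENNReal.ofReal_lt_top measure_closedBall_lt_top
  set Ebar : ℝ := (1 / 2) * mU.toReal with hEbar
  have hEbar0 : 0 ≤ Ebar := by positivity
  have hv1r : 0 < v1.toReal := ENNReal.toReal_pos v1_ne_zero v1_ne_top
  obtain ⟨n, hn⟩ := exists_nat_gt (16 * |C| * Ebar / (r0 ^ 2 * v1.toReal))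
  set N : ℝ := (n : ℝ) + 1 with hN
  have hn0 : (0 : ℝ) ≤ n := n.cast_nonneg
  have hN1 : 1 ≤ N := by rw [hN]; linarith
  have hN0 : N ≠ 0 := by positivity
  have key : ScaleLaw C (energyF (w N)) (w N) := hT (w N) (isDatum_w N)
  set E₀ : ℝ := energyF (w N) with hE₀
  have hm_le : ∫⁻ x, ‖w N x‖ₑ ^ 2 ≤ mU := mass_le hK hN1
  have hm_ne_top : (∫⁻ x, ‖w N x‖ₑ ^ 2) ≠ ⊤ := (hm_le.trans_lt hmU).ne
  have hE₀_le : E₀ ≤ Ebar := by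
    rw [hE₀, energyF, hEbar]
    exact mul_le_mul_of_nonneg_left (ENNReal.toReal_mono hmU.ne hm_le) (by norm_num)
  have hE₀_ge : v1.toReal / 4 ≤ E₀ / 2 := by
    have := ENNReal.toReal_mono hm_ne_top (v1_le_mass hN0)
    rw [hE₀, energyF]; linarith
  have hE₀_nn : 0 ≤ E₀ := energyF_nonneg _
  have hR : ENNReal.ofReal r0 ≤ Rinf E₀ (w N) := rinf_ge hK hN1 hE₀_ge
  have hX : ENNReal.ofReal (N ^ 2) * v1 ≤ ENNReal.ofReal (XF (w N)) := by
    rw [ofReal_XF]; exact xeF_ge hN0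
  have h1 : ENNReal.ofReal r0 ^ 2 * (ENNReal.ofReal (N ^ 2) * v1) ≤ ENNReal.ofReal (16 * C * E₀) :=
    (mul_le_mul' (pow_le_pow_left' hR 2) hX).trans key
  have h2 : ENNReal.ofReal r0 ^ 2 * (ENNReal.ofReal (N ^ 2) * v1) =
      ENNReal.ofReal (r0 ^ 2 * N ^ 2 * v1.toReal) := by
    rw [← ENNReal.ofReal_pow hr0pos.le, ENNReal.ofReal_mul (by positivity), ENNReal.ofReal_mul (by positivity),
      ENNReal.ofReal_toReal v1_ne_top, mul_assoc]
  have h3 : ENNReal.ofReal (16 * C * E₀) ≤ ENNReal.ofReal (16 * |C| * Ebar) := by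
    refine ENNReal.ofReal_le_ofReal ?_
    have ha : C * E₀ ≤ |C| * E₀ := mul_le_mul_of_nonneg_right (le_abs_self C) hE₀_nn
    have hb : |C| * E₀ ≤ |C| * Ebar := mul_le_mul_of_nonneg_left hE₀_le (abs_nonneg C)
    linarith
  have h4 : r0 ^ 2 * N ^ 2 * v1.toReal ≤ 16 * |C| * Ebar :=
    (ENNReal.ofReal_le_ofReal_iff (by positivity)).1 (h2 ▸ h1.trans h3)
  have h5 : 16 * |C| * Ebar < r0 ^ 2 * N ^ 2 * v1.toReal := by
    have hlt := (div_lt_iff₀ (by positivity : (0 : ℝ) < r0 ^ 2 * v1.toReal)).1 hn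
    have hnN : (n : ℝ) ≤ N ^ 2 := by rw [hN]; nlinarith
    calc 16 * |C| * Ebar < n * (r0 ^ 2 * v1.toReal) := hlt
      _ ≤ N ^ 2 * (r0 ^ 2 * v1.toReal) := by gcongr
      _ = r0 ^ 2 * N ^ 2 * v1.toReal := by ring
  linarith

/-- … hence **Theorem 2.1 as typed (along solutions) is false for every constant** — pulled back to the
initial slice by the skeleton's own bridge `thm21_field_of_thm21` (tree local existence).
[cite: Alneel2026, Theorem 2.1 p.2 l.2–6] -/
theorem not_Thm21 (C : ℝ) : ¬ Thm21 C := fun h => not_Thm21_field C (thm21_field_of_thm21 C h)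

/-- The existential face `∃ C, Thm21 C` falls with it. [cite: Alneel2026, Theorem 2.1 p.2 l.2–6; Remark 4.2] -/
theorem not_Thm21_ex : ¬ Thm21_ex := fun ⟨C, h⟩ => not_Thm21 C h

/-- The printed derivation's inputs cannot all hold: by `thm21_of_steps`, for every `C` the conjunction
Step 2 ∧ (6) ∧ (7) is false. [cite: Alneel2026, §2 proof of Thm 2.1 p.2 l.16–59] -/
theorem not_steps_2_6_7 (C : ℝ) : ¬ (Step2_localisation ∧ Step6_display C ∧ Step5_L21) :=
  fun ⟨h2, h6, h7⟩ => not_Thm21 C (thm21_of_steps C h2 h6 h7)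

end Summit.NavierStokesRegularity.NavierStokesRegularity.Theorems.Alneel2026Second

end
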